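import Summits.AtomisticToContinuum.FouriersLaw.Theorems.OddSectorIrreversibilityCorrectorTheoryDetFlow
import Mathlib.Analysis.ODE.Gronwall
import Literature.MathematicalPhysics.KineticTheory.LangevinChainConfined
import Literature.Barriers.AtomisticToContinuum.MacroErgodicityHypothesis

/-!
# `CorrectorTheory` (stmt-AtomisticToContinuum-14071), part 7b: growth of the tangent flow of the closed chain

Helper file for support item `stmt-AtomisticToContinuum-14071`
(`OddSectorIrreversibility.CorrectorTheory`, conjunct A (7): the leak identity pairs `∂_{p_b} u`
with the TANGENT map `∂_{p_b}(j_i ∘ Φ_s)` of the closed flow, which must be shown to lie in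
`L²(e^{-H/T} dx)`).

For the isolated pinned anharmonic chain `P₀ = pinnedChain ω₂ lam β 0` with `ω₂, lam > 0`,
`β ≥ 0` and its Hamiltonian field `Y`:

* `abs_hessPotential_le`, `norm_fderiv_drift_le` — on the box `|q_i| ≤ a`:
  `‖DY‖ ≤ K(a) := 1 + N ((ω₂ + 3 lam a²) + N² (1 + 12 β a²))` (sup norms);
* `lipschitzOnWith_drift_box` — `Y` is `K(a)`-Lipschitz on the convex box `|q_i| ≤ a, |p_i| ≤ b`;
* `box_of_hamiltonian_le` — the energy shell `{H ≤ E}` lies in the box as soon as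
  `E ≤ lam a⁴/4` and `2E ≤ b²` (quartic pinning: `|q| ≲ E^{1/4}`);
* `dist_detFlow_le` — **Grönwall**: two trajectories issued below the level `E` separate at most
  like `e^{K(a) t}` (Mathlib's `dist_le_of_trajectories_ODE_of_mem`, the trajectories staying in
  their energy shell by conservation);
* `norm_fderiv_detFlow_le` — hence `‖DΦ_t(x)‖ ≤ e^{K(a) t}` whenever `H(x) + 1 ≤ lam a⁴/4`,
  `2(H(x)+1) ≤ b²` — a tangent growth `exp(t·O(1 + √H))`, sub-Gaussian against `e^{-H/T}`.

References: V. I. Arnold, Ordinary Differential Equations, §27.6; folklore. Nothing here closes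
the item.
-/

noncomputable section

open MeasureTheory Filter Topology Set Function Metric
open scoped ContDiff NNReal
open Literature.MathematicalPhysics.KineticTheory.HeatConduction
open Literature.MathematicalPhysics.KineticTheory
open Summit.AtomisticToContinuum.FouriersLaw.Theorems.ClosedConeSensitivity.Negative.ZeroFrictionDictionary

namespace Summit.AtomisticToContinuum.FouriersLaw.Theorems.OddSectorIrreversibility.Corrector

variable {N : ℕ}

/-- `|[p] - [q]| ≤ 1` for indicator differences. [folklore] -/
theorem abs_ite_sub_ite_le_one (p q : Prop) [Decidable p] [Decidable q] :
    |(if p then (1 : ℝ) else 0) - (if q then (1 : ℝ) else 0)| ≤ 1 := by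
  split_ifs <;> norm_num

section Pinned

variable {ω₂ lam β : ℝ} (hω : 0 < ω₂) (hl : 0 < lam) (hβ : 0 ≤ β)
include hω hl hβ

/-- **Hessian entries on a box**: if `|q_i| ≤ a` for all `i` then
`|∂²Φ/∂q_j∂q_i| ≤ (ω₂ + 3 lam a²) + N² (1 + 12 β a²)`. [folklore] -/
theorem abs_hessPotential_le {a : ℝ} {q : Fin N → ℝ} (hq : ∀ i, |q i| ≤ a) (i j : Fin N) :
    |(pinnedChain ω₂ lam β 0).hessPotential N i j q| ≤
      (ω₂ + 3 * lam * a ^ 2) + (N : ℝ) ^ 2 * (1 + 12 * β * a ^ 2) := by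
  unfold OscillatorChain.hessPotential
  have hU2 : ∀ r, deriv (deriv (pinnedChain ω₂ lam β 0).U) r = ω₂ + 3 * lam * r ^ 2 :=
    Literature.Barriers.AtomisticToContinuum.pinnedChain_deriv_deriv_U ω₂ lam β 0
  have hV2 : ∀ r, deriv (deriv (pinnedChain ω₂ lam β 0).V) r = 1 + 3 * β * r ^ 2 :=
    pinnedChain_deriv_deriv_V ω₂ lam β 0
  have hsq : ∀ i, q i ^ 2 ≤ a ^ 2 := fun i => by
    have := hq i; rw [← sq_abs]; exact pow_le_pow_left₀ (abs_nonneg _) this 2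
  -- pinning term
  have h1 : |deriv (deriv (pinnedChain ω₂ lam β 0).U) (q i) * (if i = j then 1 else 0)| ≤ ω₂ + 3 * lam * a ^ 2 := by
    rw [hU2, abs_mul]
    have hnn : 0 ≤ ω₂ + 3 * lam * q i ^ 2 := by positivity
    rw [abs_of_nonneg hnn]
    have hind : |(if i = j then (1 : ℝ) else 0)| ≤ 1 := by split_ifs <;> norm_num
    calc (ω₂ + 3 * lam * q i ^ 2) * |(if i = j then (1 : ℝ) else 0)| ≤ (ω₂ + 3 * lam * q i ^ 2) * 1 :=
          mul_le_mul_of_nonneg_left hind hnn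
      _ ≤ ω₂ + 3 * lam * a ^ 2 := by nlinarith [hsq i, hl.le]
  -- interaction terms
  have h2 : ∀ k l : Fin N, |(if l.val = k.val + 1 then
      deriv (deriv (pinnedChain ω₂ lam β 0).V) (q l - q k) * ((if l = j then 1 else 0) - (if k = j then 1 else 0)) *
        ((if l = i then 1 else 0) - (if k = i then 1 else 0)) else (0 : ℝ))| ≤ 1 + 12 * β * a ^ 2 := by
    intro k l
    have hbound : 0 ≤ 1 + 12 * β * a ^ 2 := by positivity
    by_cases hlk : l.val = k.val + 1
    · rw [if_pos hlk, hV2, abs_mul, abs_mul]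
      have hr : (q l - q k) ^ 2 ≤ 4 * a ^ 2 := by
        have h1 := abs_le.1 (hq l); have h2 := abs_le.1 (hq k)
        nlinarith [sq_nonneg (q l - q k - 2 * a), sq_nonneg (q l - q k + 2 * a)]
      have hVnn : 0 ≤ 1 + 3 * β * (q l - q k) ^ 2 := by positivity
      rw [abs_of_nonneg hVnn]
      calc (1 + 3 * β * (q l - q k) ^ 2) * |(if l = j then (1 : ℝ) else 0) - (if k = j then 1 else 0)| *
            |(if l = i then (1 : ℝ) else 0) - (if k = i then 1 else 0)|
          ≤ (1 + 3 * β * (q l - q k) ^ 2) * 1 * 1 := by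
            refine mul_le_mul (mul_le_mul_of_nonneg_left (abs_ite_sub_ite_le_one _ _) hVnn)
              (abs_ite_sub_ite_le_one _ _) (abs_nonneg _) (by positivity)
        _ ≤ 1 + 12 * β * a ^ 2 := by nlinarith [hr, hβ]
    · rw [if_neg hlk, abs_zero]; exact hbound
  calc _ ≤ |deriv (deriv (pinnedChain ω₂ lam β 0).U) (q i) * (if i = j then 1 else 0)| +
        |∑ k : Fin N, ∑ l : Fin N, (if l.val = k.val + 1 then
          deriv (deriv (pinnedChain ω₂ lam β 0).V) (q l - q k) * ((if l = j then 1 else 0) - (if k = j then 1 else 0)) *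
            ((if l = i then 1 else 0) - (if k = i then 1 else 0)) else (0 : ℝ))| := abs_add_le _ _
    _ ≤ (ω₂ + 3 * lam * a ^ 2) + ∑ k : Fin N, ∑ l : Fin N, (1 + 12 * β * a ^ 2) := by
        refine add_le_add h1 ((Finset.abs_sum_le_sum_abs _ _).trans (Finset.sum_le_sum fun k _ =>
          (Finset.abs_sum_le_sum_abs _ _).trans (Finset.sum_le_sum fun l _ => h2 k l)))
    _ = (ω₂ + 3 * lam * a ^ 2) + (N : ℝ) ^ 2 * (1 + 12 * β * a ^ 2) := by
        simp only [Finset.sum_const, Finset.card_univ, Fintype.card_fin, nsmul_eq_mul]; ring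

/-- **The derivative of the Hamiltonian field on a box** (sup norms on phase space): if
`|q_i| ≤ a` for all `i` then `‖DY(z)‖ ≤ 1 + N ((ω₂ + 3 lam a²) + N² (1 + 12 β a²))`. [folklore] -/
theorem norm_fderiv_drift_le {a : ℝ} {z : PhaseSpace N} (hz : ∀ i, |z.1 i| ≤ a) :
    ‖fderiv ℝ ((pinnedChain ω₂ lam β 0).drift N) z‖ ≤
      1 + N * ((ω₂ + 3 * lam * a ^ 2) + (N : ℝ) ^ 2 * (1 + 12 * β * a ^ 2)) := by
  set h : ℝ := (ω₂ + 3 * lam * a ^ 2) + (N : ℝ) ^ 2 * (1 + 12 * β * a ^ 2) with hh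
  have hh0 : 0 ≤ h := by positivity
  have hK0 : 0 ≤ 1 + N * h := by positivity
  have hU : ContDiff ℝ ∞ (pinnedChain ω₂ lam β 0).U := pinnedChain_contDiff_U ω₂ lam β 0
  have hV : ContDiff ℝ ∞ (pinnedChain ω₂ lam β 0).V := pinnedChain_contDiff_V ω₂ lam β 0
  refine ContinuousLinearMap.opNorm_le_bound _ hK0 fun w => ?_
  rw [(pinnedChain ω₂ lam β 0).fderiv_drift_apply hU hV N z w]
  have hγ : (pinnedChain ω₂ lam β 0).γ = 0 := rfl
  simp only [hγ, zero_mul, sub_zero]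
  rw [Prod.norm_def, max_le_iff]
  constructor
  · calc ‖w.2‖ ≤ ‖w‖ := norm_snd_le w
      _ ≤ (1 + N * h) * ‖w‖ := by nlinarith [norm_nonneg w, mul_nonneg (Nat.cast_nonneg N) hh0]
  · refine (pi_norm_le_iff_of_nonneg (by positivity)).2 fun i => ?_
    rw [Real.norm_eq_abs, abs_neg]
    calc |∑ j, (pinnedChain ω₂ lam β 0).hessPotential N i j z.1 * w.1 j|
        ≤ ∑ j, |(pinnedChain ω₂ lam β 0).hessPotential N i j z.1 * w.1 j| := Finset.abs_sum_le_sum_abs _ _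
      _ ≤ ∑ _j : Fin N, h * ‖w‖ := Finset.sum_le_sum fun j _ => by
          rw [abs_mul]
          refine mul_le_mul (abs_hessPotential_le hω hl hβ hz i j) ?_ (abs_nonneg _) hh0
          calc |w.1 j| = ‖w.1 j‖ := (Real.norm_eq_abs _).symm
            _ ≤ ‖w.1‖ := norm_le_pi_norm _ j
            _ ≤ ‖w‖ := norm_fst_le w
      _ = N * h * ‖w‖ := by rw [Finset.sum_const, Finset.card_univ, Fintype.card_fin, nsmul_eq_mul]; ring
      _ ≤ (1 + N * h) * ‖w‖ := by nlinarith [norm_nonneg w]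

/-- **The Hamiltonian field is Lipschitz on boxes**: with `K(a)` as above, `Y` is `K(a)`-Lipschitz
on `{(q,p) : ‖q‖ ≤ a, ‖p‖ ≤ b}` (convex; mean value inequality). [folklore] -/
theorem lipschitzOnWith_drift_box (a b : ℝ) :
    LipschitzOnWith (Real.toNNReal (1 + N * ((ω₂ + 3 * lam * a ^ 2) + (N : ℝ) ^ 2 * (1 + 12 * β * a ^ 2))))
      ((pinnedChain ω₂ lam β 0).drift N) {z : PhaseSpace N | ‖z.1‖ ≤ a ∧ ‖z.2‖ ≤ b} := by
  have hU : ContDiff ℝ ∞ (pinnedChain ω₂ lam β 0).U := pinnedChain_contDiff_U ω₂ lam β 0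
  have hV : ContDiff ℝ ∞ (pinnedChain ω₂ lam β 0).V := pinnedChain_contDiff_V ω₂ lam β 0
  have hd : Differentiable ℝ ((pinnedChain ω₂ lam β 0).drift N) :=
    ((pinnedChain ω₂ lam β 0).contDiff_drift hU hV N).differentiable (by simp)
  have hconv : Convex ℝ {z : PhaseSpace N | ‖z.1‖ ≤ a ∧ ‖z.2‖ ≤ b} := by
    have : {z : PhaseSpace N | ‖z.1‖ ≤ a ∧ ‖z.2‖ ≤ b} = (closedBall (0 : Fin N → ℝ) a) ×ˢ (closedBall (0 : Fin N → ℝ) b) := by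
      ext z; simp [mem_closedBall, dist_zero_right]
    rw [this]
    exact (convex_closedBall _ _).prod (convex_closedBall _ _)
  refine hconv.lipschitzOnWith_of_nnnorm_hasFDerivWithin_le (f' := fun z => fderiv ℝ ((pinnedChain ω₂ lam β 0).drift N) z)
    (fun z _ => (hd z).hasFDerivAt.hasFDerivWithinAt) fun z hz => ?_
  have hzi : ∀ i, |z.1 i| ≤ a := fun i => by
    have := norm_le_pi_norm z.1 i
    rw [Real.norm_eq_abs] at this
    exact this.trans hz.1
  have h := norm_fderiv_drift_le hω hl hβ hzi
  rw [← NNReal.coe_le_coe, coe_nnnorm, Real.coe_toNNReal _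
    (le_trans (norm_nonneg _) h)]
  exact h

/-- **The energy shell lies in a box**: if `H(z) ≤ E`, `E ≤ lam a⁴/4` and `2E ≤ b²` (`a, b ≥ 0`)
then `‖q‖ ≤ a` and `‖p‖ ≤ b` (`lam q_i⁴/4 ≤ U(q_i) ≤ H`, `p_i²/2 ≤ H`). [folklore] -/
theorem box_of_hamiltonian_le {E a b : ℝ} (ha : 0 ≤ a) (hb : 0 ≤ b) (haE : E ≤ lam * a ^ 4 / 4)
    (hbE : 2 * E ≤ b ^ 2) {z : PhaseSpace N} (hz : (pinnedChain ω₂ lam β 0).hamiltonian N z ≤ E) :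
    ‖z.1‖ ≤ a ∧ ‖z.2‖ ≤ b := by
  set P₀ := pinnedChain ω₂ lam β 0 with hP₀
  have hU0 : ∀ q, 0 ≤ P₀.U q := fun q => by show 0 ≤ ω₂ * q ^ 2 / 2 + lam * q ^ 4 / 4; positivity
  have hV0 : ∀ r, 0 ≤ P₀.V r := fun r => by show 0 ≤ r ^ 2 / 2 + β * r ^ 4 / 4; positivity
  have hsite : ∀ i, z.2 i ^ 2 / 2 + P₀.U (z.1 i) ≤ E := fun i => (P₀.site_le_hamiltonian hU0 hV0 N z i).trans hz
  constructor
  · refine (pi_norm_le_iff_of_nonneg ha).2 fun i => ?_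
    rw [Real.norm_eq_abs]
    have h1 := hsite i
    have hUq : lam * (z.1 i) ^ 4 / 4 ≤ P₀.U (z.1 i) := by
      show lam * (z.1 i) ^ 4 / 4 ≤ ω₂ * (z.1 i) ^ 2 / 2 + lam * (z.1 i) ^ 4 / 4
      nlinarith [sq_nonneg (z.1 i), hω.le]
    have h4 : (z.1 i) ^ 4 ≤ a ^ 4 := by nlinarith [sq_nonneg (z.2 i)]
    have h4' : |z.1 i| ^ 4 ≤ a ^ 4 := by rwa [pow_abs, abs_of_nonneg (by positivity : (0:ℝ) ≤ z.1 i ^ 4)]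
    exact le_of_pow_le_pow_left₀ (by norm_num) ha h4'
  · refine (pi_norm_le_iff_of_nonneg hb).2 fun i => ?_
    rw [Real.norm_eq_abs]
    have h1 := hsite i
    have hp : (z.2 i) ^ 2 ≤ b ^ 2 := by nlinarith [hU0 (z.1 i)]
    exact abs_le_of_sq_le_sq' hp hb |>.elim (fun h1 h2 => abs_le.2 ⟨h1, h2⟩)


/-- **Grönwall for the closed flow.** With `K(a) = 1 + N((ω₂ + 3 lam a²) + N²(1 + 12 β a²))`:
two trajectories issued below the energy level `E` (`E ≤ lam a⁴/4`, `2E ≤ b²`) satisfy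
`dist (Φ_t x) (Φ_t y) ≤ dist x y · e^{K(a) t}` — they stay in their energy shells
(conservation), which lie in the box where `Y` is `K(a)`-Lipschitz. [folklore] -/
theorem dist_detFlow_le {E a b : ℝ} (ha : 0 ≤ a) (hb : 0 ≤ b) (haE : E ≤ lam * a ^ 4 / 4)
    (hbE : 2 * E ≤ b ^ 2) {x y : PhaseSpace N} (hx : (pinnedChain ω₂ lam β 0).hamiltonian N x ≤ E)
    (hy : (pinnedChain ω₂ lam β 0).hamiltonian N y ≤ E) {t : ℝ} (ht : 0 ≤ t) :
    dist (detFlow ω₂ lam β N t x) (detFlow ω₂ lam β N t y) ≤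
      dist x y * Real.exp ((1 + N * ((ω₂ + 3 * lam * a ^ 2) + (N : ℝ) ^ 2 * (1 + 12 * β * a ^ 2))) * t) := by
  set K : ℝ := 1 + N * ((ω₂ + 3 * lam * a ^ 2) + (N : ℝ) ^ 2 * (1 + 12 * β * a ^ 2)) with hK
  have hK0 : 0 ≤ K := by positivity
  set B : Set (PhaseSpace N) := {z | ‖z.1‖ ≤ a ∧ ‖z.2‖ ≤ b} with hB
  have hlip := lipschitzOnWith_drift_box hω hl hβ (N := N) a b
  have hmem : ∀ z : PhaseSpace N, (pinnedChain ω₂ lam β 0).hamiltonian N z ≤ E → ∀ s : ℝ, 0 ≤ s →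
      detFlow ω₂ lam β N s z ∈ B := fun z hz s hs => by
    refine box_of_hamiltonian_le hω hl hβ ha hb haE hbE ?_
    rw [hamiltonian_detFlow hω hl.le hβ N hs]
    exact hz
  have h0 : ∀ z : PhaseSpace N, detFlow ω₂ lam β N 0 z = z := fun z =>
    detFlow_of_nonpos (ω₂ := ω₂) (lam := lam) (β := β) N le_rfl z
  have h := dist_le_of_trajectories_ODE_of_mem (v := fun _ => (pinnedChain ω₂ lam β 0).drift N)
    (s := fun _ => B) (K := Real.toNNReal K) (f := fun s => detFlow ω₂ lam β N s x)
    (g := fun s => detFlow ω₂ lam β N s y) (a := 0) (b := t) (δ := dist x y)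
    (fun _ _ => hlip)
    ((continuous_detFlow_time hω hl.le hβ N x).continuousOn)
    (fun s hs => hasDerivWithinAt_detFlow hω hl.le hβ N x hs.1)
    (fun s hs => hmem x hx s hs.1)
    ((continuous_detFlow_time hω hl.le hβ N y).continuousOn)
    (fun s hs => hasDerivWithinAt_detFlow hω hl.le hβ N y hs.1)
    (fun s hs => hmem y hy s hs.1)
    (by rw [h0, h0]) t ⟨ht, le_rfl⟩
  rw [Real.coe_toNNReal _ hK0, sub_zero] at h
  exact h

/-- **Tangent growth of the closed flow**: `‖DΦ_t(x)‖ ≤ e^{K(a) t}` as soon as the level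
`H(x) + 1` fits in the box (`H(x) + 1 ≤ lam a⁴/4`, `2(H(x)+1) ≤ b²`): the flow is
`e^{K(a)t}`-Lipschitz on the neighbourhood `{H < H(x) + 1}` of `x`. [folklore] -/
theorem norm_fderiv_detFlow_le {a b : ℝ} (ha : 0 ≤ a) (hb : 0 ≤ b) {x : PhaseSpace N}
    (haE : (pinnedChain ω₂ lam β 0).hamiltonian N x + 1 ≤ lam * a ^ 4 / 4)
    (hbE : 2 * ((pinnedChain ω₂ lam β 0).hamiltonian N x + 1) ≤ b ^ 2) {t : ℝ} (ht : 0 ≤ t) :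
    ‖fderiv ℝ (detFlow ω₂ lam β N t) x‖ ≤
      Real.exp ((1 + N * ((ω₂ + 3 * lam * a ^ 2) + (N : ℝ) ^ 2 * (1 + 12 * β * a ^ 2))) * t) := by
  set K : ℝ := 1 + N * ((ω₂ + 3 * lam * a ^ 2) + (N : ℝ) ^ 2 * (1 + 12 * β * a ^ 2)) with hK
  set E : ℝ := (pinnedChain ω₂ lam β 0).hamiltonian N x + 1 with hE
  set s : Set (PhaseSpace N) := {y | (pinnedChain ω₂ lam β 0).hamiltonian N y < E} with hs
  have hso : IsOpen s := isOpen_lt (pinnedChain_continuous_hamiltonian ω₂ lam β 0 N) continuous_const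
  have hxs : x ∈ s := by show (pinnedChain ω₂ lam β 0).hamiltonian N x < E; rw [hE]; linarith
  have hsn : s ∈ 𝓝 x := hso.mem_nhds hxs
  have hlip : LipschitzOnWith (Real.toNNReal (Real.exp (K * t))) (detFlow ω₂ lam β N t) s := by
    refine LipschitzOnWith.of_dist_le_mul fun y hy z hz => ?_
    rw [Real.coe_toNNReal _ (Real.exp_pos _).le, mul_comm]
    exact dist_detFlow_le hω hl hβ ha hb haE hbE (le_of_lt hy) (le_of_lt hz) ht
  have hdiff : DifferentiableAt ℝ (detFlow ω₂ lam β N t) x :=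
    ((contDiff_detFlow hω hl.le hβ N ht).differentiable (by simp)) x
  have h := hdiff.hasFDerivAt.le_of_lipschitzOn hsn hlip
  rwa [Real.coe_toNNReal _ (Real.exp_pos _).le] at h

end Pinned

end Summit.AtomisticToContinuum.FouriersLaw.Theorems.OddSectorIrreversibility.Corrector

end
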